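import Literature.MathematicalPhysics.QuantumFieldTheory.Balaban1983to89.Beta.LargeLWindow

/-!
# `Balaban1983to89.Beta.FlowConsumers` — the [III]-side consumers ((2.6)–(2.9) AND (2.46) along runs) for EVERY
kernel-carried form of the β sub-cell's wall: the minimal form `EventualForm`, the (MB)/drift form `BoundedForm`,
the one-step / large-`L` form (AF-0-L) `LargeL.LogGrowthLower(On)`, and the window form `LargeLWindow.WindowDecomposition`
(cell `pub-balaban`, unit `b2b-balaban-strat-b14` = β sub-cell CO-LEAD, [III] side; node T11.F)

HONEST FRAMING (cell rule, verbatim, page 1 of everything): discharging `BetaPertH` makes Bałaban's UV stability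
UNCONDITIONAL — a real constructive-QFT result; it is NOT the continuum limit and NOT the Clay problem.  (Gloss, cell
BETA-SPEC v1.8d: «unconditional» in [Balaban1989LargeFieldII] p. 355's interval-hypothesis sense only.)  THIS MODULE
DISCHARGES NOTHING: every theorem below is bookkeeping over real sequences — «hypothesis shape on the one-loop /
β-values ⇒ the displayed inequalities (2.6), (2.7), (2.8), (2.9) pp. 255–256 and (2.46) p. 263 of [Balaban1988Convergent]
along the in-interval runs of a forward-generated construction».  Nothing about Bałaban's β-functions (1.22) is asserted;
every hypothesis structure consumed here (`Beta.Assembly.EventualForm`, `Beta.Assembly.BoundedForm`,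
`Beta.LargeL.LogGrowthLower`, `Beta.LargeLWindow.WindowDecomposition`) is a located UNPRINTED input of the cell's census
(B12 p. 259/p. 264 «separate paper», B16 p. 355 «has not been published yet»), asserted of nothing.

ABSOLUTE RULE (cell rule, verbatim): "No internally-minted statement may enter as a cited fact. Every hypothesis is
either kernel-proved in this package or a verbatim quotation of a PUBLISHED theorem with page reference. The
manuscript(s) under audit are NOT citable for their own disputed steps — they are the thing under adjudication;
programme-internal (2001/route/tribunal) claims are never citable."

CITATION HEADER (lean-in-tree rule 2026-08-18).  Sources under audit: T. Bałaban, *Convergent renormalization expansions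
for lattice gauge theories*, Commun. Math. Phys. **119**, 243–285 (1988) [Balaban1988Convergent] (cell paper B14 = [III];
the flow inequalities (2.5)–(2.9) pp. 255–256 and the coupling-sum inequality (2.46) p. 263 — typed in `B14.lean` /
`B14FlowStep.lean`, whose headers carry the verbatim displays); T. Bałaban, *Renormalization group approach to lattice
gauge field theories. I*, Commun. Math. Phys. **109**, 249–301 (1987) [Balaban1987RG1] (B12 = [I]; (0.20) p. 256, Thm 2
p. 259, the split (2.12)–(2.14) p. 268, (1.22) and «uniformly bounded on this interval» p. 264 — through `FlowStep`,
`FlowStepRuns`, `B12Beta`); T. Bałaban, *Large field renormalization. II*, Commun. Math. Phys. **122**, 355–392 (1989)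
[Balaban1989LargeFieldII] (B16; p. 355 reading — through `DagBinding` / `FlowStepRuns` §8).  What is reproduced: NOTHING is
newly quoted; every printed display enters through the imported modules.  The theorems carry the cite of the display
they conclude, exactly as `FlowStepRuns` §11 and `Beta.Assembly` §1.5 do.

WHY THIS MODULE (cell BETA-SPEC §5 / §5.5–§5.7 / §7.6, MISSING-B14.md §9).  The cell has typed the located unprinted flow
input in four interchangeable-for-the-END-statement forms.  Their [I]-side consumers (endpoint existence, Theorem 2 as
printed, the p. 355 reading) are all landed (`Beta.Assembly`, `Beta.Transfer`, `Beta.LargeL`, `Beta.LargeLWindow`).  On the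
[III] side — ALL of (2.6)–(2.9) with the printed constants and the middle member of (2.46) along every in-interval run,
i.e. the input of [III] Thm 2 / Cor. 3 and of B16 §1 (MISSING-B14 §8 consumer census C1–C13) — the tree carried the
consumer theorem only for the LIMIT form (`Beta.Assembly.LimitForm.flowControl_along`); `EventualForm` had the world-level
`p355_and_sum246` but not the run-wise list, `BoundedForm` had neither (its docstring names `B14FlowStep.flowControl_of_driftSplit`
as the intended [III]-side consumer, to be bridged by this unit), and `Beta.LargeL` / `Beta.LargeLWindow` — the sub-cell's
PRIMARY road (AF-0-L) — had no [III]-side consumer at all.  This module supplies them, composing the history→run dictionary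
`FlowStepRuns.realised_eq_hist` with `B14FlowStep` §J exactly as `FlowStepRuns.flowControl_along_of_limitSplit` does:
  §1 `EventualForm`: `eventualForm_flowControl_along` (sizes `R_j` of (2.5) produced).
  §2 (MB)/drift form: `avgAF_along_of_marginalBounded` — bounded oscillation `|Σ_{j<k}β⁰_{j+1} − kB| ≤ R` of the coupling-free
     parts + (AF-1) `|β¹_{k+1}| ≤ C g_k` with `2Cγ ≤ B` give AVERAGED asymptotic freedom with slope `B/2` and defect `2R` along
     every in-interval run; hence `flowControl_along_of_marginalBounded`(′) and, for the carrier, `boundedForm_flowControl_along`,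
     `boundedForm_sum246_along`, `boundedForm_p355_and_sum246` (the (MB) form DOES give (2.46) — it is only the literal
     pointwise (0.31) that it does not give).
  §3 (AF-0-L) at `L ≥ L₁(b, A, b₀)` with the constant-form remainder `r ≤ b₀` (row an4) and the printed upper bound: the
     POINTWISE form (`k₀ = 0`), so NO defect condition and NO lower half of (TS) is needed — `largeL_flowControl_along`,
     `largeL_flowControl_along_on` (admissible `L`), `largeL_p355_and_sum246`; the `L` of (AF-0-L) IS the `L` of (2.5)/(2.9)
     (`B14FlowStep.SmallnessFor γ β′ β₀ L p`), so the [III]-side smallness is of the CELL's "γ chosen after L" type (a cell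
     phrase, BETA-SPEC §5.7 — not a quotation), i.e. consistent with the series' order of constants (L fixed first).
  §4 the window form: `largeLWindow_flowControl_along`, `largeLWindow_p355_and_sum246` (`b = I/log 2`, `A = constA`).
VALUE = kernel bookkeeping closing the consumer DAG of the primary road on the [III] side; NOT summit progress, NOT a
discharge.  0 sorry; no new definition; no new hypothesis shape.
v1.1 (DOCSTRING ONLY; XREAD b2b-balaban-pv25 C-pv25g3-9 non-blocking nit): the cell phrase "γ chosen after L" (BETA-SPEC §5.7) is no
longer set in guillemets (v1 l.54 / `largeL_flowControl_along`), so that no cell phrase can be mistaken for a quotation of the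
series; every declaration byte-unchanged.

(v1.1, unit strat-b14 gen 9, 2026-08-19; APPEND-ONLY — every v1 declaration byte-unchanged; no new import) §6 `DriftCarrier`:
the drift predicate `Beta.Drift.OneLoopDrift b A β⁰` (row an1; the END-statement grade of the lead's PROPOSED road V22,
BETA-SPEC §7.15 (R9-iv), NOT adopted, nothing of it asserted) is LITERALLY the (MB) predicate `Transfer.MarginalBounded β⁰ b A`
of §2 (`oneLoopDrift_iff_marginalBounded`), so the whole [III] list along runs is served from it verbatim
(`drift_flowControl_along[']`, `drift_avgAF_along`, `drift_sum246_along`) — the co-lead's answer to §7.15 (d)(v).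
-/

namespace Literature.MathematicalPhysics.QuantumFieldTheory.Balaban1983to89.Beta.FlowConsumers

open Literature.MathematicalPhysics.QuantumFieldTheory.Balaban1983to89
open Literature.MathematicalPhysics.QuantumFieldTheory.Balaban1983to89.FlowStep
open Literature.MathematicalPhysics.QuantumFieldTheory.Balaban1983to89.DagBinding
open Literature.MathematicalPhysics.QuantumFieldTheory.Balaban1983to89.FlowStepRuns
open Literature.MathematicalPhysics.QuantumFieldTheory.Balaban1983to89.Beta.Assembly
open Literature.MathematicalPhysics.QuantumFieldTheory.Balaban1983to89.Beta.RemainderChain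
open Literature.MathematicalPhysics.QuantumFieldTheory.Balaban1983to89.Beta.AssemblyRemainder
open Literature.MathematicalPhysics.QuantumFieldTheory.Balaban1983to89.Beta.LargeL (LogGrowthLower LogGrowthLowerOn L₁
  two_le_L₁)
open Literature.MathematicalPhysics.QuantumFieldTheory.Balaban1983to89.Beta.LargeLWindow (WindowDecomposition)
open Literature.MathematicalPhysics.QuantumFieldTheory.Balaban1983to89.Beta.WindowLog (DyadicRate shellSum)
open Literature.MathematicalPhysics.QuantumFieldTheory.Balaban1983to89.Beta.DyadicShell (Pt)

noncomputable section

/-! ## 1. The minimal form `EventualForm`: (2.6)–(2.9) AND (2.46) along runs, sizes produced -/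

/-- **[III] side of the MINIMAL form.**  For a forward-generated construction that halts outside and curries `β`, a
carrier `E : EventualForm β` ((EV-AF) `β_{k+1} ≥ b > 0` on ]0,γ₀]^{k+1} for `k ≥ k₀` — OPEN for (1.22); (TS) the printed
two-sided bound; (C)), strat-b14's `SmallnessFor γ β′ β₀ L p` with `γ ≤ γ₀` and the γ-smallness of the defect
`(b+β′)k₀` — `(b+β′)k₀γ² ≤ β₀(2+β₀)`, `(b+β′)k₀γ² ≤ 1/2`, `(√2)^{κ₀−6}(2γ⁴/b + γ⁶) < 1`: along every run staying in ]0,γ] up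
to `K` there ARE sizes `R_j` obeying (2.5) for which ALL of (2.6), (2.7), (2.8) (for `ε_j = g_jA₀(log g_j⁻²)^p`), (2.9) with
the printed constants and (2.46) for every `κ₀ ≥ 6` hold (`FlowStepRuns.flowControl_along_of_eventualLower'`).  No split, no
rate, no small-k signs. [cite: Balaban1988Convergent, (2.5)–(2.9) pp.255–256 and (2.46) p.263] -/
theorem eventualForm_flowControl_along {β : HBeta} (E : EventualForm β) {C : B12.Construction}
    (hgen : ForwardGenerated C β) (hhalt : HaltsOutside C β) (hcur : CurriesHBeta C β) {γ β₀ : ℝ} {L p : ℕ}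
    (Sm : B14FlowStep.SmallnessFor γ E.β' β₀ L p) {A₀ : ℝ} (hA₀ : 0 ≤ A₀) (hγ : γ ≤ E.γ₀)
    (hBγ : (E.b + E.β') * E.k₀ * γ ^ 2 ≤ β₀ * (2 + β₀)) (hBγ' : (E.b + E.β') * E.k₀ * γ ^ 2 ≤ 1 / 2)
    {κ₀ : ℕ} (hκ : 6 ≤ κ₀) (hsmall : Real.sqrt 2 ^ (κ₀ - 6) * (2 * γ ^ 4 / E.b + γ ^ 6) < 1)
    (P : B12.RunParams) (hI : (C P).flow.InInterval γ P.K) :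
    ∃ R : ℕ → ℕ, (∀ j, B14.IsRj L p ((C P).flow.g j) (R j)) ∧
      (B14.FlowIneq26 (C P).flow.g E.β' β₀ P.K ∧ B14.FlowIneq27 (C P).flow.g E.β' β₀ p P.K ∧
        B14.FlowIneq28 (epsK A₀ p (C P).flow) (C P).flow.g E.β' β₀ P.K ∧
        B14FlowStep.FlowIneq29 R (C P).flow.g L E.β' β₀ P.K) ∧ B14FlowStep.SumIneq246 (C P).flow.g κ₀ P.K :=
  flowControl_along_of_eventualLower' hgen hhalt hcur Sm hA₀ hγ E.b_pos E.tail E.lower E.upper hBγ hBγ' hκ hsmall P hI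

/-! ## 2. The (MB)/drift form: bounded oscillation of the accumulated coupling-free parts + (AF-1) ⇒ AVERAGED
asymptotic freedom with a defect along runs ⇒ (2.6)–(2.9) AND (2.46) -/

/-- Window sums under bounded oscillation: `|Σ_{j<k} b_j − kB| ≤ R` for all `k` gives
`B(n−m) − 2R ≤ Σ_{j∈[m,n)} b_j`. [folklore] -/
theorem sum_Ico_ge_of_marginalBounded {b : ℕ → ℝ} {B R : ℝ} (hacc : Transfer.MarginalBounded b B R) {m n : ℕ}
    (hmn : m ≤ n) : B * ((n : ℝ) - m) - 2 * R ≤ ∑ j ∈ Finset.Ico m n, b j := by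
  have hn := (abs_le.mp (hacc n)).1
  have hm := (abs_le.mp (hacc m)).2
  have hIco : ∑ j ∈ Finset.Ico m n, b j = Transfer.accum b n - Transfer.accum b m := by
    unfold Transfer.accum; exact Finset.sum_Ico_eq_sub _ hmn
  rw [hIco]
  linarith

/-- **(AvAF) along runs from the (MB) form — the history→run bridge.**  For a construction currying `β`, a split
`β = β⁰ + β¹` (`B12Beta.OneLoopSplit`, [Balaban1987RG1] (2.12)–(2.14)) whose coupling-free parts have bounded oscillation
`|Σ_{j<k}β⁰_{j+1} − kB| ≤ R` (`Beta.Transfer.MarginalBounded`; OPEN for (1.22)) and whose remainder obeys (AF-1)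
`|β¹_{k+1}(g_0,…,g_k)| ≤ C g_k` on ]0,γ₀]-histories (OPEN, row an4) with `0 ≤ C` and `2Cγ ≤ B`: along every run staying
in ]0,γ] (`γ ≤ γ₀`) up to `K`, `(B/2)(n−m) − 2R ≤ Σ_{j∈[m,n)} β_{j+1}(g_j)` for all `m ≤ n ≤ K` — averaged asymptotic freedom
with slope `B/2` and defect `2R` in the sense of `B14FlowStep.flowControl_of_avgAF`. [folklore] -/
theorem avgAF_along_of_marginalBounded {C : B12.Construction} {β : HBeta} (hcur : CurriesHBeta C β)
    (S : B12Beta.OneLoopSplit β) {γ γ₀ B R Cr : ℝ} (hγ₀ : γ ≤ γ₀) (hacc : Transfer.MarginalBounded S.β0 B R)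
    (hAF1 : ∀ k (q : Fin (k + 1) → ℝ), q ∈ B12Beta.HistBox γ₀ k → |S.β1 k q| ≤ Cr * q (Fin.last k))
    (hCr : 0 ≤ Cr) (hCrγ : 2 * (Cr * γ) ≤ B) (P : B12.RunParams) (hI : (C P).flow.InInterval γ P.K) :
    ∀ m n, m ≤ n → n ≤ P.K →
      B / 2 * ((n : ℝ) - m) - 2 * R ≤ ∑ j ∈ Finset.Ico m n, (C P).flow.β (j + 1) ((C P).flow.g j) := by
  intro m n hmn hnK
  have hpt : ∀ j ∈ Finset.Ico m n, S.β0 j - B / 2 ≤ (C P).flow.β (j + 1) ((C P).flow.g j) := by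
    intro j hj
    have hjK : j < P.K := lt_of_lt_of_le (Finset.mem_Ico.mp hj).2 hnK
    obtain ⟨hpt, hbox⟩ := realised_eq_hist hcur P hγ₀ hI hjK
    have hlast : prefixOf (C P).flow.g j (Fin.last j) ≤ γ := by
      rw [prefixOf_apply, Fin.val_last]; exact (hI j hjK.le).2
    have h1 := (abs_le.mp (hAF1 j _ (histBox_of_mem_box hbox))).1
    have h2 : Cr * prefixOf (C P).flow.g j (Fin.last j) ≤ Cr * γ := mul_le_mul_of_nonneg_left hlast hCr
    rw [hpt, S.split j]
    linarith
  have hsum := Finset.sum_le_sum hpt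
  have hs : ∑ j ∈ Finset.Ico m n, (S.β0 j - B / 2)
      = ∑ j ∈ Finset.Ico m n, S.β0 j - B / 2 * ((n : ℝ) - m) := by
    rw [Finset.sum_sub_distrib, Finset.sum_const, Nat.card_Ico, nsmul_eq_mul, Nat.cast_sub hmn]; ring
  rw [hs] at hsum
  have hdrift := sum_Ico_ge_of_marginalBounded hacc hmn
  linarith

/-- **(2.6)–(2.9) AND (2.46) along an in-interval run from the (MB) form.**  For a forward-generated construction that
halts outside and curries `β`, split `β = β⁰ + β¹` with bounded oscillation `|Σ_{j<k}β⁰_{j+1} − kB| ≤ R`, `B > 0` (OPEN),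
(AF-1) with `0 ≤ C`, `2Cγ ≤ B` (OPEN), the PRINTED upper bound `β ≤ β′` on ]0,γ₀]-boxes ([Balaban1987RG1] p. 264),
`SmallnessFor γ β′ β₀ L p` (`γ ≤ γ₀`), sizes `R_j` as in (2.5), and γ-smallness of the defect `2R`: `2Rγ² ≤ β₀(2+β₀)`,
`2Rγ² ≤ 1/2`, `(√2)^{κ₀−6}(2γ⁴/(B/2) + γ⁶) < 1` — ALL of (2.6), (2.7), (2.8), (2.9) with the printed constants and (2.46)
for every `κ₀ ≥ 6` (`B14FlowStep.flowControl_of_avgAF`).  No limit, no rate, no pointwise sign of any `β⁰_{k+1}`.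
[cite: Balaban1988Convergent, (2.6)–(2.9) pp.255–256 and (2.46) p.263] -/
theorem flowControl_along_of_marginalBounded {C : B12.Construction} {β : HBeta} (hgen : ForwardGenerated C β)
    (hhalt : HaltsOutside C β) (hcur : CurriesHBeta C β) (S : B12Beta.OneLoopSplit β)
    {γ γ₀ B R Cr β' β₀ : ℝ} {L p : ℕ} (Sm : B14FlowStep.SmallnessFor γ β' β₀ L p) {A₀ : ℝ} (hA₀ : 0 ≤ A₀)
    (hγ₀ : γ ≤ γ₀) (hB : 0 < B) (hacc : Transfer.MarginalBounded S.β0 B R)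
    (hAF1 : ∀ k (q : Fin (k + 1) → ℝ), q ∈ B12Beta.HistBox γ₀ k → |S.β1 k q| ≤ Cr * q (Fin.last k))
    (hCr : 0 ≤ Cr) (hCrγ : 2 * (Cr * γ) ≤ B) (hup : BetaUpperH β' γ₀ β)
    (hRγ : 2 * R * γ ^ 2 ≤ β₀ * (2 + β₀)) (hRγ' : 2 * R * γ ^ 2 ≤ 1 / 2) {κ₀ : ℕ} (hκ : 6 ≤ κ₀)
    (hsmall : Real.sqrt 2 ^ (κ₀ - 6) * (2 * γ ^ 4 / (B / 2) + γ ^ 6) < 1)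
    (P : B12.RunParams) (hI : (C P).flow.InInterval γ P.K)
    (Rj : ℕ → ℕ) (hRj : ∀ j, j ≤ P.K → B14.IsRj L p ((C P).flow.g j) (Rj j)) :
    (B14.FlowIneq26 (C P).flow.g β' β₀ P.K ∧ B14.FlowIneq27 (C P).flow.g β' β₀ p P.K ∧
      B14.FlowIneq28 (epsK A₀ p (C P).flow) (C P).flow.g β' β₀ P.K ∧
      B14FlowStep.FlowIneq29 Rj (C P).flow.g L β' β₀ P.K) ∧ B14FlowStep.SumIneq246 (C P).flow.g κ₀ P.K := by
  have hrg : (C P).flow.SatisfiesRG P.K := satisfiesRG_of_inInterval hgen hhalt hcur P hI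
  have hub : ∀ j, j < P.K → (C P).flow.β (j + 1) ((C P).flow.g j) ≤ β' := by
    intro j hj
    obtain ⟨hpt, hbox⟩ := realised_eq_hist hcur P hγ₀ hI hj
    rw [hpt]; exact hup j _ hbox
  exact B14FlowStep.flowControl_of_avgAF (C P).flow P.K Sm hA₀ Rj hRj hrg hI hub (half_pos hB)
    (avgAF_along_of_marginalBounded hcur S hγ₀ hacc hAF1 hCr hCrγ P hI) hRγ hRγ' hκ hsmall

/-- **Sizes supplied** (as `FlowStepRuns.flowControl_along_of_limitSplit'`): along every in-interval run there ARE sizes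
`R_j` obeying (2.5) (`B14FlowStep.isRj_exists`, `L ≥ 2` from `SmallnessFor`) for which the whole list holds, from the (MB)
form. [cite: Balaban1988Convergent, (2.5)–(2.9) pp.255–256 and (2.46) p.263] -/
theorem flowControl_along_of_marginalBounded' {C : B12.Construction} {β : HBeta} (hgen : ForwardGenerated C β)
    (hhalt : HaltsOutside C β) (hcur : CurriesHBeta C β) (S : B12Beta.OneLoopSplit β)
    {γ γ₀ B R Cr β' β₀ : ℝ} {L p : ℕ} (Sm : B14FlowStep.SmallnessFor γ β' β₀ L p) {A₀ : ℝ} (hA₀ : 0 ≤ A₀)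
    (hγ₀ : γ ≤ γ₀) (hB : 0 < B) (hacc : Transfer.MarginalBounded S.β0 B R)
    (hAF1 : ∀ k (q : Fin (k + 1) → ℝ), q ∈ B12Beta.HistBox γ₀ k → |S.β1 k q| ≤ Cr * q (Fin.last k))
    (hCr : 0 ≤ Cr) (hCrγ : 2 * (Cr * γ) ≤ B) (hup : BetaUpperH β' γ₀ β)
    (hRγ : 2 * R * γ ^ 2 ≤ β₀ * (2 + β₀)) (hRγ' : 2 * R * γ ^ 2 ≤ 1 / 2) {κ₀ : ℕ} (hκ : 6 ≤ κ₀)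
    (hsmall : Real.sqrt 2 ^ (κ₀ - 6) * (2 * γ ^ 4 / (B / 2) + γ ^ 6) < 1)
    (P : B12.RunParams) (hI : (C P).flow.InInterval γ P.K) :
    ∃ Rj : ℕ → ℕ, (∀ j, B14.IsRj L p ((C P).flow.g j) (Rj j)) ∧
      (B14.FlowIneq26 (C P).flow.g β' β₀ P.K ∧ B14.FlowIneq27 (C P).flow.g β' β₀ p P.K ∧
        B14.FlowIneq28 (epsK A₀ p (C P).flow) (C P).flow.g β' β₀ P.K ∧
        B14FlowStep.FlowIneq29 Rj (C P).flow.g L β' β₀ P.K) ∧ B14FlowStep.SumIneq246 (C P).flow.g κ₀ P.K := by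
  choose Rj hRj using fun j => B14FlowStep.isRj_exists Sm.hL p ((C P).flow.g j)
  exact ⟨Rj, hRj, flowControl_along_of_marginalBounded hgen hhalt hcur S Sm hA₀ hγ₀ hB hacc hAF1 hCr hCrγ hup hRγ hRγ'
    hκ hsmall P hI Rj fun j _ => hRj j⟩

/-- **(2.46) alone along an in-interval run from the (MB) form** (no `SmallnessFor`, no sizes): `2Rγ² ≤ 1/2`,
`(√2)^{κ₀−6}(2γ⁴/(B/2) + γ⁶) < 1`, `κ₀ ≥ 6` (`B14FlowStep.sumIneq246_of_avgAF`). [cite: Balaban1988Convergent, (2.46) p.263] -/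
theorem sum246_along_of_marginalBounded {C : B12.Construction} {β : HBeta} (hgen : ForwardGenerated C β)
    (hhalt : HaltsOutside C β) (hcur : CurriesHBeta C β) (S : B12Beta.OneLoopSplit β) {γ γ₀ B R Cr : ℝ}
    (hγ₀ : γ ≤ γ₀) (hB : 0 < B) (hacc : Transfer.MarginalBounded S.β0 B R)
    (hAF1 : ∀ k (q : Fin (k + 1) → ℝ), q ∈ B12Beta.HistBox γ₀ k → |S.β1 k q| ≤ Cr * q (Fin.last k))
    (hCr : 0 ≤ Cr) (hCrγ : 2 * (Cr * γ) ≤ B) (hRγ' : 2 * R * γ ^ 2 ≤ 1 / 2) {κ₀ : ℕ} (hκ : 6 ≤ κ₀)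
    (hsmall : Real.sqrt 2 ^ (κ₀ - 6) * (2 * γ ^ 4 / (B / 2) + γ ^ 6) < 1)
    (P : B12.RunParams) (hI : (C P).flow.InInterval γ P.K) :
    B14FlowStep.SumIneq246 (C P).flow.g κ₀ P.K :=
  B14FlowStep.sumIneq246_of_avgAF (C P).flow P.K (half_pos hB) (satisfiesRG_of_inInterval hgen hhalt hcur P hI) hI
    (avgAF_along_of_marginalBounded hcur S hγ₀ hacc hAF1 hCr hCrγ P hI) hRγ' hκ hsmall

/-! ### 2′ The same read on the carrier `Beta.Assembly.BoundedForm` -/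

/-- **[III] side of the (MB) carrier**: for `M : BoundedForm β` and a run interval `γ ≤ γ₀` with `2Cγ ≤ B`, the defect
smallness `2Rγ² ≤ β₀(2+β₀)`, `2Rγ² ≤ 1/2` and `(√2)^{κ₀−6}(2γ⁴/(B/2) + γ⁶) < 1`: along every in-interval run of a
forward-generated construction currying `β` there are sizes `R_j` of (2.5) with ALL of (2.6)–(2.9) (printed constants) AND
(2.46), `κ₀ ≥ 6`.  This is the consumer announced in `Beta.Assembly` §2′ («its [III]-side run-level consumer is
`B14FlowStep.flowControl_of_driftSplit` (unit strat-b14)»), in history typing. [cite: Balaban1988Convergent, (2.5)–(2.9) pp.255–256 and (2.46) p.263] -/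
theorem boundedForm_flowControl_along {β : HBeta} (M : BoundedForm β) {C : B12.Construction}
    (hgen : ForwardGenerated C β) (hhalt : HaltsOutside C β) (hcur : CurriesHBeta C β) {γ β₀ : ℝ} {L p : ℕ}
    (Sm : B14FlowStep.SmallnessFor γ M.β' β₀ L p) {A₀ : ℝ} (hA₀ : 0 ≤ A₀) (hγ : γ ≤ M.γ₀)
    (hCrγ : 2 * (M.Cr * γ) ≤ M.B) (hRγ : 2 * M.R * γ ^ 2 ≤ β₀ * (2 + β₀)) (hRγ' : 2 * M.R * γ ^ 2 ≤ 1 / 2)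
    {κ₀ : ℕ} (hκ : 6 ≤ κ₀) (hsmall : Real.sqrt 2 ^ (κ₀ - 6) * (2 * γ ^ 4 / (M.B / 2) + γ ^ 6) < 1)
    (P : B12.RunParams) (hI : (C P).flow.InInterval γ P.K) :
    ∃ Rj : ℕ → ℕ, (∀ j, B14.IsRj L p ((C P).flow.g j) (Rj j)) ∧
      (B14.FlowIneq26 (C P).flow.g M.β' β₀ P.K ∧ B14.FlowIneq27 (C P).flow.g M.β' β₀ p P.K ∧
        B14.FlowIneq28 (epsK A₀ p (C P).flow) (C P).flow.g M.β' β₀ P.K ∧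
        B14FlowStep.FlowIneq29 Rj (C P).flow.g L M.β' β₀ P.K) ∧ B14FlowStep.SumIneq246 (C P).flow.g κ₀ P.K :=
  flowControl_along_of_marginalBounded' hgen hhalt hcur M.S Sm hA₀ hγ M.B_pos M.osc M.af1 M.Cr_nonneg hCrγ M.upper
    hRγ hRγ' hκ hsmall P hI

/-- **(2.46) along in-interval runs from the (MB) carrier** — the (MB) form DOES give the coupling-sum inequality
(contrast: it does not give the literal pointwise (0.31), `Beta.Assembly` §2′). [cite: Balaban1988Convergent, (2.46) p.263] -/
theorem boundedForm_sum246_along {β : HBeta} (M : BoundedForm β) {C : B12.Construction}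
    (hgen : ForwardGenerated C β) (hhalt : HaltsOutside C β) (hcur : CurriesHBeta C β) {γ : ℝ} (hγ : γ ≤ M.γ₀)
    (hCrγ : 2 * (M.Cr * γ) ≤ M.B) (hRγ' : 2 * M.R * γ ^ 2 ≤ 1 / 2) {κ₀ : ℕ} (hκ : 6 ≤ κ₀)
    (hsmall : Real.sqrt 2 ^ (κ₀ - 6) * (2 * γ ^ 4 / (M.B / 2) + γ ^ 6) < 1)
    (P : B12.RunParams) (hI : (C P).flow.InInterval γ P.K) :
    B14FlowStep.SumIneq246 (C P).flow.g κ₀ P.K :=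
  sum246_along_of_marginalBounded hgen hhalt hcur M.S hγ M.B_pos M.osc M.af1 M.Cr_nonneg hCrγ hRγ' hκ hsmall P hI

/-- **The cell's END statement WITH (2.46), from the (MB) carrier** (`BoundedForm.p355` + `boundedForm_sum246_along`): for a
world whose interval is small — `γ ≤ γ₀`, `2Cγ ≤ B`, `β′ ≤ β⁺`, `2Rγ² ≤ β₀(2+β₀)`, `2Rγ² ≤ 1/2`,
`(√2)^{κ₀−6}(2γ⁴/(B/2) + γ⁶) < 1` — the p. 355 unconditional reading AND (2.46) along every in-interval run; no limit, no
rate, no pointwise sign. [cite: Balaban1989LargeFieldII, p.355; Balaban1988Convergent, (2.46) p.263] -/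
theorem boundedForm_p355_and_sum246 {β : HBeta} (M : BoundedForm β) (w : World) (hγw : 0 < w.γ)
    (hγ₀ : w.γ ≤ M.γ₀) (hCrγ : 2 * (M.Cr * w.γ) ≤ M.B) (hβup : M.β' ≤ w.βup)
    (hMγ : 2 * M.R * w.γ ^ 2 ≤ w.β₀ * (2 + w.β₀)) (hRγ' : 2 * M.R * w.γ ^ 2 ≤ 1 / 2) {κ₀ : ℕ} (hκ : 6 ≤ κ₀)
    (hsmall : Real.sqrt 2 ^ (κ₀ - 6) * (2 * w.γ ^ 4 / (M.B / 2) + w.γ ^ 6) < 1)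
    (hnodes : ∀ P, Nodes (leaves w P)) (hgen : ForwardGenerated w.C.toB12 β) (hhalt : HaltsOutside w.C.toB12 β)
    (hcur : CurriesHBeta w.C.toB12 β) :
    (B16.Sect2Unconditional w.C ∧
      ∃ Em Ep : ℝ, ∀ m : ℕ, ∃ gstar : ℝ, 0 < gstar ∧ ∀ g : ℝ, 0 < g → g ≤ gstar →
        ∀ K : ℕ, ∃ g0 : ℝ, (w.C ⟨K, m, g0⟩).flow.g K = g ∧
          ∀ k, k ≤ K → ∀ V : (w.C ⟨K, m, g0⟩).Cfg k, B16.UVIneq (w.C ⟨K, m, g0⟩) k V Em Ep) ∧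
    ∀ P : B12.RunParams, (w.C.toB12 P).flow.InInterval w.γ P.K →
      B14FlowStep.SumIneq246 (w.C.toB12 P).flow.g κ₀ P.K := by
  have hCrγ1 : M.Cr * w.γ ≤ M.B := by nlinarith [M.Cr_nonneg, hγw.le]
  exact ⟨M.p355 w hγw hγ₀ hCrγ1 hβup hMγ hnodes hgen hhalt hcur,
    fun P hI => boundedForm_sum246_along M hgen hhalt hcur hγ₀ hCrγ hRγ' hκ hsmall P hI⟩

/-! ## 3. The one-step / large-`L` form (AF-0-L): the POINTWISE form on the [III] side (`k₀ = 0`, no defect) -/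

section LargeL

variable {β0 : ℕ → ℕ → ℝ} {b A b₀ : ℝ} {L : ℕ} {β : HBeta} (S : B12Beta.OneLoopSplit β)

/-- From a POINTWISE positive lower bound `b₀ ≤ β_{k+1}` on all ]0,γ₀]-boxes (all `k`) and the printed upper bound:
(2.6)–(2.9) AND (2.46) along every in-interval run (`γ ≤ γ₀`), with NO defect condition — the `k₀ = 0` case of
`FlowStepRuns.flowControl_along_of_eventualLower'`; the lower half `−β′ ≤ β` of (TS) is implied (`β′ ≥ 0` from
`SmallnessFor`).  Smallness: `SmallnessFor γ β′ β₀ L p` and `(√2)^{κ₀−6}(2γ⁴/b₀ + γ⁶) < 1`, `κ₀ ≥ 6`.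
[cite: Balaban1988Convergent, (2.5)–(2.9) pp.255–256 and (2.46) p.263] -/
theorem flowControl_along_of_betaLowerH {C : B12.Construction} (hgen : ForwardGenerated C β)
    (hhalt : HaltsOutside C β) (hcur : CurriesHBeta C β) {γ γ₀ β' β₀ : ℝ} {p : ℕ}
    (Sm : B14FlowStep.SmallnessFor γ β' β₀ L p) {A₀ : ℝ} (hA₀ : 0 ≤ A₀) (hγ : γ ≤ γ₀) (hb₀ : 0 < b₀)
    (hlow : BetaLowerH b₀ γ₀ β) (hup : BetaUpperH β' γ₀ β) {κ₀ : ℕ} (hκ : 6 ≤ κ₀)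
    (hsmall : Real.sqrt 2 ^ (κ₀ - 6) * (2 * γ ^ 4 / b₀ + γ ^ 6) < 1)
    (P : B12.RunParams) (hI : (C P).flow.InInterval γ P.K) :
    ∃ R : ℕ → ℕ, (∀ j, B14.IsRj L p ((C P).flow.g j) (R j)) ∧
      (B14.FlowIneq26 (C P).flow.g β' β₀ P.K ∧ B14.FlowIneq27 (C P).flow.g β' β₀ p P.K ∧
        B14.FlowIneq28 (epsK A₀ p (C P).flow) (C P).flow.g β' β₀ P.K ∧
        B14FlowStep.FlowIneq29 R (C P).flow.g L β' β₀ P.K) ∧ B14FlowStep.SumIneq246 (C P).flow.g κ₀ P.K := by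
  have hlo : ∀ k, ∀ v ∈ Box γ₀ k, -β' ≤ β k v := fun k v hv => by
    linarith [hlow k v hv, Sm.β'_nonneg]
  have h0 : (b₀ + β') * ((0 : ℕ) : ℝ) * γ ^ 2 = 0 := by simp
  exact flowControl_along_of_eventualLower' (k₀ := 0) hgen hhalt hcur Sm hA₀ hγ hb₀ (fun k _ v hv => hlow k v hv) hlo
    hup (by rw [h0]; nlinarith [Sm.β₀_pos]) (by rw [h0]; norm_num) hκ hsmall P hI

/-- **[III] side of (AF-0-L).**  From the large-`L` shape `LogGrowthLower β0 b A` (`b > 0`; OPEN for (1.22) — the lead's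
typed target, BETA-SPEC §8.6), a blocking factor `L ≥ L₁(b, A, b₀)` (`b₀ > 0`), the dictionary `S.β0 = β0 L`, row an4's
CONSTANT-FORM remainder `|β¹_{k+1}| ≤ r ≤ b₀` on ]0,γ₀]-histories and the PRINTED upper bound `β ≤ β′` on the boxes: along
every in-interval run (`γ ≤ γ₀`) of a forward-generated construction currying `β`, sizes `R_j` of (2.5) exist with ALL of
(2.6)–(2.9) (printed constants) AND (2.46), `κ₀ ≥ 6`.  POINTWISE form: `k₀ = 0`, so no defect smallness and no lower half
of (TS); the `L` of (AF-0-L) is the `L` of (2.5)/(2.9) (`SmallnessFor γ β′ β₀ L p`), i.e. the [III]-side smallness is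
"γ chosen after L" (a cell phrase, BETA-SPEC §5.7 — not a quotation). [cite: Balaban1988Convergent, (2.5)–(2.9) pp.255–256 and (2.46) p.263] -/
theorem largeL_flowControl_along (h : LogGrowthLower β0 b A) (hb : 0 < b) (hL : L₁ b A b₀ ≤ L)
    (hS : ∀ k, S.β0 k = β0 L k) {γ₀ r β' : ℝ} (hb₀ : 0 < b₀) (hrem : RemainderConst S γ₀ r) (hr : r ≤ b₀)
    (hup : BetaUpperH β' γ₀ β) {C : B12.Construction} (hgen : ForwardGenerated C β) (hhalt : HaltsOutside C β)
    (hcur : CurriesHBeta C β) {γ β₀ : ℝ} {p : ℕ} (Sm : B14FlowStep.SmallnessFor γ β' β₀ L p) {A₀ : ℝ}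
    (hA₀ : 0 ≤ A₀) (hγ : γ ≤ γ₀) {κ₀ : ℕ} (hκ : 6 ≤ κ₀)
    (hsmall : Real.sqrt 2 ^ (κ₀ - 6) * (2 * γ ^ 4 / b₀ + γ ^ 6) < 1)
    (P : B12.RunParams) (hI : (C P).flow.InInterval γ P.K) :
    ∃ R : ℕ → ℕ, (∀ j, B14.IsRj L p ((C P).flow.g j) (R j)) ∧
      (B14.FlowIneq26 (C P).flow.g β' β₀ P.K ∧ B14.FlowIneq27 (C P).flow.g β' β₀ p P.K ∧
        B14.FlowIneq28 (epsK A₀ p (C P).flow) (C P).flow.g β' β₀ P.K ∧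
        B14FlowStep.FlowIneq29 R (C P).flow.g L β' β₀ P.K) ∧ B14FlowStep.SumIneq246 (C P).flow.g κ₀ P.K :=
  flowControl_along_of_betaLowerH hgen hhalt hcur Sm hA₀ hγ hb₀ (LargeL.betaLowerH S h hb hL hS hrem hr) hup hκ
    hsmall P hI

/-- The same from the shape relativised to ADMISSIBLE blocking factors (`LogGrowthLowerOn Adm`, e.g. `L` odd and `> 11`,
[Balaban1987RG1] p. 251), at an admissible `L ≥ L₁`. [cite: Balaban1988Convergent, (2.5)–(2.9) pp.255–256 and (2.46) p.263] -/
theorem largeL_flowControl_along_on {Adm : ℕ → Prop} (h : LogGrowthLowerOn Adm β0 b A) (hb : 0 < b) (hAdm : Adm L)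
    (hL : L₁ b A b₀ ≤ L) (hS : ∀ k, S.β0 k = β0 L k) {γ₀ r β' : ℝ} (hb₀ : 0 < b₀) (hrem : RemainderConst S γ₀ r)
    (hr : r ≤ b₀) (hup : BetaUpperH β' γ₀ β) {C : B12.Construction} (hgen : ForwardGenerated C β)
    (hhalt : HaltsOutside C β) (hcur : CurriesHBeta C β) {γ β₀ : ℝ} {p : ℕ}
    (Sm : B14FlowStep.SmallnessFor γ β' β₀ L p) {A₀ : ℝ} (hA₀ : 0 ≤ A₀) (hγ : γ ≤ γ₀) {κ₀ : ℕ} (hκ : 6 ≤ κ₀)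
    (hsmall : Real.sqrt 2 ^ (κ₀ - 6) * (2 * γ ^ 4 / b₀ + γ ^ 6) < 1)
    (P : B12.RunParams) (hI : (C P).flow.InInterval γ P.K) :
    ∃ R : ℕ → ℕ, (∀ j, B14.IsRj L p ((C P).flow.g j) (R j)) ∧
      (B14.FlowIneq26 (C P).flow.g β' β₀ P.K ∧ B14.FlowIneq27 (C P).flow.g β' β₀ p P.K ∧
        B14.FlowIneq28 (epsK A₀ p (C P).flow) (C P).flow.g β' β₀ P.K ∧
        B14FlowStep.FlowIneq29 R (C P).flow.g L β' β₀ P.K) ∧ B14FlowStep.SumIneq246 (C P).flow.g κ₀ P.K :=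
  flowControl_along_of_betaLowerH hgen hhalt hcur Sm hA₀ hγ hb₀
    (betaLowerH_of_split_const S (LargeL.af0_all_on S h hb hAdm hL hS) hrem hr) hup hκ hsmall P hI

/-- **The cell's END statement WITH (2.46), from (AF-0-L)** — the p. 355 unconditional reading AND (2.46) along every
in-interval run of the world's construction, via the minimal carrier with `k₀ = 0` (`Beta.LargeL.eventualForm` +
`Beta.Assembly.EventualForm.p355_and_sum246`): inputs (AF-0-L) at `L ≥ L₁`, the constant-form remainder `r ≤ b₀`, the
printed two-sided bound, (C), and a world interval with `γ ≤ γ₀`, `β′ ≤ β⁺`, `(√2)^{κ₀−6}(2γ⁴/b₀ + γ⁶) < 1` — NO defect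
condition (the slots `β⁺k₀γ² ≤ …` are vacuous at `k₀ = 0`). [cite: Balaban1989LargeFieldII, p.355; Balaban1988Convergent, (2.46) p.263] -/
theorem largeL_p355_and_sum246 (h : LogGrowthLower β0 b A) (hb : 0 < b) (hL : L₁ b A b₀ ≤ L)
    (hS : ∀ k, S.β0 k = β0 L k) {γ₀ r β' : ℝ} (hγ₀ : 0 < γ₀) (hb₀ : 0 < b₀) (hrem : RemainderConst S γ₀ r)
    (hr : r ≤ b₀) (hup : BetaUpperH β' γ₀ β) (hlo : ∀ k, ∀ v ∈ Box γ₀ k, -β' ≤ β k v) (hcont : BetaContH γ₀ β)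
    (w : World) (hγw : 0 < w.γ) (hγ₀w : w.γ ≤ γ₀) (hβup : β' ≤ w.βup) {κ₀ : ℕ} (hκ : 6 ≤ κ₀)
    (hsmall : Real.sqrt 2 ^ (κ₀ - 6) * (2 * w.γ ^ 4 / b₀ + w.γ ^ 6) < 1)
    (hnodes : ∀ P, Nodes (leaves w P)) (hgen : ForwardGenerated w.C.toB12 β) (hhalt : HaltsOutside w.C.toB12 β)
    (hcur : CurriesHBeta w.C.toB12 β) :
    (B16.Sect2Unconditional w.C ∧
      ∃ Em Ep : ℝ, ∀ m : ℕ, ∃ gstar : ℝ, 0 < gstar ∧ ∀ g : ℝ, 0 < g → g ≤ gstar →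
        ∀ K : ℕ, ∃ g0 : ℝ, (w.C ⟨K, m, g0⟩).flow.g K = g ∧
          ∀ k, k ≤ K → ∀ V : (w.C ⟨K, m, g0⟩).Cfg k, B16.UVIneq (w.C ⟨K, m, g0⟩) k V Em Ep) ∧
    ∀ P : B12.RunParams, (w.C.toB12 P).flow.InInterval w.γ P.K →
      B14FlowStep.SumIneq246 (w.C.toB12 P).flow.g κ₀ P.K := by
  have h0 : ((LargeL.eventualForm S h hb hL hS hγ₀ hb₀ hrem hr hup hlo hcont).k₀ : ℝ) = 0 := by
    rw [(LargeL.eventualForm_k₀ S h hb hL hS hγ₀ hb₀ hrem hr hup hlo hcont).1, Nat.cast_zero]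
  exact (LargeL.eventualForm S h hb hL hS hγ₀ hb₀ hrem hr hup hlo hcont).p355_and_sum246 w hγw hγ₀w hβup
    (by rw [h0, mul_zero, zero_mul]; nlinarith [w.β₀_pos]) (by rw [h0, mul_zero, zero_mul]; norm_num) hκ hsmall
    hnodes hgen hhalt hcur

end LargeL

/-! ## 4. The window form: `WindowDecomposition ∧ I > 0 ∧ L ≥ L₁(I/log 2, A(I), b₀)` on the [III] side -/

section Window

variable {β0 : ℕ → ℕ → ℝ} {h : Pt → ℝ} {Ch Cg A₁ c : ℝ} {M : ℕ → ℕ} {I C₀ b₀ : ℝ} {L : ℕ} {β : HBeta}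
  (S : B12Beta.OneLoopSplit β)

/-- `I/log 2 > 0` for `I > 0`. [folklore] -/
theorem slope_pos (hIpos : 0 < I) : 0 < I / Real.log 2 := div_pos hIpos (Real.log_pos (by norm_num))

/-- **[III] side of the window form**: the window decomposition of the one-loop coefficients (rows an1/an2/an5; OPEN), a
positive coefficient `I > 0` carried with any proved dyadic rate ((L5); OPEN), `L ≥ L₁(I/log 2, A(I), b₀)`, the
constant-form remainder `r ≤ b₀` and the printed upper bound give, along every in-interval run, sizes `R_j` of (2.5) with
ALL of (2.6)–(2.9) AND (2.46) (`Beta.LargeLWindow.WindowDecomposition.logGrowthLower` + §3).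
[cite: Balaban1988Convergent, (2.5)–(2.9) pp.255–256 and (2.46) p.263] -/
theorem largeLWindow_flowControl_along (W : WindowDecomposition β0 h Ch Cg A₁ c M)
    (hI : DyadicRate (shellSum h) I C₀) (hIpos : 0 < I)
    (hL : L₁ (I / Real.log 2) (WindowDecomposition.constA Ch Cg A₁ c I) b₀ ≤ L) (hS : ∀ k, S.β0 k = β0 L k)
    {γ₀ r β' : ℝ} (hb₀ : 0 < b₀) (hrem : RemainderConst S γ₀ r) (hr : r ≤ b₀) (hup : BetaUpperH β' γ₀ β)
    {C : B12.Construction} (hgen : ForwardGenerated C β) (hhalt : HaltsOutside C β) (hcur : CurriesHBeta C β)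
    {γ β₀ : ℝ} {p : ℕ} (Sm : B14FlowStep.SmallnessFor γ β' β₀ L p) {A₀ : ℝ} (hA₀ : 0 ≤ A₀) (hγ : γ ≤ γ₀)
    {κ₀ : ℕ} (hκ : 6 ≤ κ₀) (hsmall : Real.sqrt 2 ^ (κ₀ - 6) * (2 * γ ^ 4 / b₀ + γ ^ 6) < 1)
    (P : B12.RunParams) (hIn : (C P).flow.InInterval γ P.K) :
    ∃ R : ℕ → ℕ, (∀ j, B14.IsRj L p ((C P).flow.g j) (R j)) ∧
      (B14.FlowIneq26 (C P).flow.g β' β₀ P.K ∧ B14.FlowIneq27 (C P).flow.g β' β₀ p P.K ∧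
        B14.FlowIneq28 (epsK A₀ p (C P).flow) (C P).flow.g β' β₀ P.K ∧
        B14FlowStep.FlowIneq29 R (C P).flow.g L β' β₀ P.K) ∧ B14FlowStep.SumIneq246 (C P).flow.g κ₀ P.K :=
  largeL_flowControl_along S (W.logGrowthLower hI hIpos.le) (slope_pos hIpos) hL hS hb₀ hrem hr hup hgen hhalt hcur Sm
    hA₀ hγ hκ hsmall P hIn

/-- **The cell's END statement WITH (2.46), from the window form** (§3 `largeL_p355_and_sum246` at `b = I/log 2`,
`A = A(I)`). [cite: Balaban1989LargeFieldII, p.355; Balaban1988Convergent, (2.46) p.263] -/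
theorem largeLWindow_p355_and_sum246 (W : WindowDecomposition β0 h Ch Cg A₁ c M)
    (hI : DyadicRate (shellSum h) I C₀) (hIpos : 0 < I)
    (hL : L₁ (I / Real.log 2) (WindowDecomposition.constA Ch Cg A₁ c I) b₀ ≤ L) (hS : ∀ k, S.β0 k = β0 L k)
    {γ₀ r β' : ℝ} (hγ₀ : 0 < γ₀) (hb₀ : 0 < b₀) (hrem : RemainderConst S γ₀ r) (hr : r ≤ b₀)
    (hup : BetaUpperH β' γ₀ β) (hlo : ∀ k, ∀ v ∈ Box γ₀ k, -β' ≤ β k v) (hcont : BetaContH γ₀ β)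
    (w : World) (hγw : 0 < w.γ) (hγ₀w : w.γ ≤ γ₀) (hβup : β' ≤ w.βup) {κ₀ : ℕ} (hκ : 6 ≤ κ₀)
    (hsmall : Real.sqrt 2 ^ (κ₀ - 6) * (2 * w.γ ^ 4 / b₀ + w.γ ^ 6) < 1)
    (hnodes : ∀ P, Nodes (leaves w P)) (hgen : ForwardGenerated w.C.toB12 β) (hhalt : HaltsOutside w.C.toB12 β)
    (hcur : CurriesHBeta w.C.toB12 β) :
    (B16.Sect2Unconditional w.C ∧
      ∃ Em Ep : ℝ, ∀ m : ℕ, ∃ gstar : ℝ, 0 < gstar ∧ ∀ g : ℝ, 0 < g → g ≤ gstar →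
        ∀ K : ℕ, ∃ g0 : ℝ, (w.C ⟨K, m, g0⟩).flow.g K = g ∧
          ∀ k, k ≤ K → ∀ V : (w.C ⟨K, m, g0⟩).Cfg k, B16.UVIneq (w.C ⟨K, m, g0⟩) k V Em Ep) ∧
    ∀ P : B12.RunParams, (w.C.toB12 P).flow.InInterval w.γ P.K →
      B14FlowStep.SumIneq246 (w.C.toB12 P).flow.g κ₀ P.K :=
  largeL_p355_and_sum246 S (W.logGrowthLower hI hIpos.le) (slope_pos hIpos) hL hS hγ₀ hb₀ hrem hr hup hlo hcont w hγw
    hγ₀w hβup hκ hsmall hnodes hgen hhalt hcur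

end Window

/-! ## 5. Non-vacuity: the carriers consumed above are inhabited (witnesses of the imported modules), so no theorem of
this module is vacuously true by an empty hypothesis structure -/

/-- The `EventualForm` / `BoundedForm` carriers are inhabited (`Beta.Assembly.Witness`). [folklore] -/
theorem carriers_nonvacuous :
    Nonempty (EventualForm Assembly.Witness.constOne) ∧ Nonempty (BoundedForm Assembly.Witness.constOne) :=
  ⟨Assembly.Witness.eventualForm_nonvacuous, Assembly.Witness.boundedForm_nonvacuous⟩

/-- The (AF-0-L) shape is inhabited (`Beta.LargeL.Witness.logGrowthLower_model`) and so is the window structure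
(`Beta.LargeLWindow.Witness.windowDecomposition_model`). [folklore] -/
theorem shapes_nonvacuous :
    LogGrowthLower (fun L _ => (1 : ℝ) * Real.log L) 1 0 ∧
      WindowDecomposition LargeLWindow.Witness.betaModel DyadicShell.Witness.quartic 30 0 0 1 id :=
  ⟨LargeL.Witness.logGrowthLower_model 1, LargeLWindow.Witness.windowDecomposition_model⟩

/-! ## 6. (v1.1) The DRIFT carrier `Beta.Drift.OneLoopDrift` (row an1's (T-drift); the END-statement grade of the
lead's PROPOSED road V22 «one-shot / telescoping», BETA-SPEC §7.15 (R9-iv)) IS the (MB) carrier of §2 — so the whole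
[III] list along runs is served from it VERBATIM.  Co-lead's answer to §7.15 (d)(v) «read (R9-iv) against [III]»:
`Drift.OneLoopDrift b A β⁰` and `Transfer.MarginalBounded β⁰ b A` are the same predicate (`Transfer.accum β⁰ k = Σ_{j<k} β⁰_j`,
up to `b·k = k·b`); hence under V22's conclusion `OneLoopDrift (b log L) A β⁰` (`OneShotTelescope.oneLoopDrift_of_telescope`,
IF (T1)/(T2) are certified — nothing of V22 is asserted here) plus (AF-1) on ]0,γ₀]-histories, §2 gives (2.6)–(2.9) with
the printed constants AND (2.46) along every in-interval run, slope `b/2`, defect `2A`: NO EventualForm, NO prefix, NO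
small-k sign, NO L → ∞.  Bookkeeping only. -/

section DriftCarrier

/-- The drift predicate of `Beta.Drift` IS the bounded-oscillation predicate of `Beta.Transfer`:
`OneLoopDrift b A β⁰ → MarginalBounded β⁰ b A`. [folklore] -/
theorem marginalBounded_of_oneLoopDrift {b A : ℝ} {β0 : ℕ → ℝ} (h : Drift.OneLoopDrift b A β0) :
    Transfer.MarginalBounded β0 b A := by
  intro k
  have := h k
  unfold Transfer.accum
  rwa [mul_comm (k : ℝ) b]

/-- Converse: `MarginalBounded β⁰ b A → OneLoopDrift b A β⁰`. [folklore] -/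
theorem oneLoopDrift_of_marginalBounded {b A : ℝ} {β0 : ℕ → ℝ} (h : Transfer.MarginalBounded β0 b A) :
    Drift.OneLoopDrift b A β0 := by
  intro k
  have := h k
  unfold Transfer.accum at this
  rwa [mul_comm b (k : ℝ)]

/-- The two carriers are literally equivalent. [folklore] -/
theorem oneLoopDrift_iff_marginalBounded {b A : ℝ} {β0 : ℕ → ℝ} :
    Drift.OneLoopDrift b A β0 ↔ Transfer.MarginalBounded β0 b A :=
  ⟨marginalBounded_of_oneLoopDrift, oneLoopDrift_of_marginalBounded⟩

/-- **[III] side of the DRIFT carrier (V22's END-statement grade, BETA-SPEC §7.15 (R9-iv)).**  For a forward-generated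
construction that halts outside and curries `β`, a split `β = β⁰ + β¹` (`B12Beta.OneLoopSplit`) with the DRIFT
`|Σ_{j<k}β⁰_{j+1} − b·k| ≤ A` (`Drift.OneLoopDrift b A S.β0`, `b > 0`; OPEN for (1.22) — under V22 it would follow from
(T1)+(T2), themselves uncertified), (AF-1) `|β¹_{k+1}| ≤ C·g_k` on ]0,γ₀]-histories with `2Cγ ≤ b` (OPEN, row an4), the
PRINTED upper bound `β ≤ β′` on the boxes, `SmallnessFor γ β′ β₀ L p` (`γ ≤ γ₀`), sizes of (2.5), and the γ-smallness of
the defect `2Aγ² ≤ β₀(2+β₀)`, `2Aγ² ≤ 1/2`, `(√2)^{κ₀−6}(2γ⁴/(b/2) + γ⁶) < 1`: ALL of (2.6)–(2.9) with the printed constants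
AND (2.46) (`κ₀ ≥ 6`) along every in-interval run — `flowControl_along_of_marginalBounded` read through
`marginalBounded_of_oneLoopDrift`. [cite: Balaban1988Convergent, (2.6)–(2.9) pp.255–256 and (2.46) p.263] -/
theorem drift_flowControl_along {C : B12.Construction} {β : HBeta} (hgen : ForwardGenerated C β)
    (hhalt : HaltsOutside C β) (hcur : CurriesHBeta C β) (S : B12Beta.OneLoopSplit β)
    {γ γ₀ b A Cr β' β₀ : ℝ} {L p : ℕ} (Sm : B14FlowStep.SmallnessFor γ β' β₀ L p) {A₀ : ℝ} (hA₀ : 0 ≤ A₀)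
    (hγ₀ : γ ≤ γ₀) (hb : 0 < b) (hdrift : Drift.OneLoopDrift b A S.β0)
    (hAF1 : ∀ k (q : Fin (k + 1) → ℝ), q ∈ B12Beta.HistBox γ₀ k → |S.β1 k q| ≤ Cr * q (Fin.last k))
    (hCr : 0 ≤ Cr) (hCrγ : 2 * (Cr * γ) ≤ b) (hup : BetaUpperH β' γ₀ β)
    (hAγ : 2 * A * γ ^ 2 ≤ β₀ * (2 + β₀)) (hAγ' : 2 * A * γ ^ 2 ≤ 1 / 2) {κ₀ : ℕ} (hκ : 6 ≤ κ₀)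
    (hsmall : Real.sqrt 2 ^ (κ₀ - 6) * (2 * γ ^ 4 / (b / 2) + γ ^ 6) < 1)
    (P : B12.RunParams) (hI : (C P).flow.InInterval γ P.K)
    (Rj : ℕ → ℕ) (hRj : ∀ j, j ≤ P.K → B14.IsRj L p ((C P).flow.g j) (Rj j)) :
    (B14.FlowIneq26 (C P).flow.g β' β₀ P.K ∧ B14.FlowIneq27 (C P).flow.g β' β₀ p P.K ∧
      B14.FlowIneq28 (epsK A₀ p (C P).flow) (C P).flow.g β' β₀ P.K ∧
      B14FlowStep.FlowIneq29 Rj (C P).flow.g L β' β₀ P.K) ∧ B14FlowStep.SumIneq246 (C P).flow.g κ₀ P.K :=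
  flowControl_along_of_marginalBounded hgen hhalt hcur S Sm hA₀ hγ₀ hb (marginalBounded_of_oneLoopDrift hdrift) hAF1
    hCr hCrγ hup hAγ hAγ' hκ hsmall P hI Rj hRj

/-- Sizes supplied (`B14FlowStep.isRj_exists`). [cite: Balaban1988Convergent, (2.5)–(2.9) pp.255–256 and (2.46) p.263] -/
theorem drift_flowControl_along' {C : B12.Construction} {β : HBeta} (hgen : ForwardGenerated C β)
    (hhalt : HaltsOutside C β) (hcur : CurriesHBeta C β) (S : B12Beta.OneLoopSplit β)
    {γ γ₀ b A Cr β' β₀ : ℝ} {L p : ℕ} (Sm : B14FlowStep.SmallnessFor γ β' β₀ L p) {A₀ : ℝ} (hA₀ : 0 ≤ A₀)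
    (hγ₀ : γ ≤ γ₀) (hb : 0 < b) (hdrift : Drift.OneLoopDrift b A S.β0)
    (hAF1 : ∀ k (q : Fin (k + 1) → ℝ), q ∈ B12Beta.HistBox γ₀ k → |S.β1 k q| ≤ Cr * q (Fin.last k))
    (hCr : 0 ≤ Cr) (hCrγ : 2 * (Cr * γ) ≤ b) (hup : BetaUpperH β' γ₀ β)
    (hAγ : 2 * A * γ ^ 2 ≤ β₀ * (2 + β₀)) (hAγ' : 2 * A * γ ^ 2 ≤ 1 / 2) {κ₀ : ℕ} (hκ : 6 ≤ κ₀)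
    (hsmall : Real.sqrt 2 ^ (κ₀ - 6) * (2 * γ ^ 4 / (b / 2) + γ ^ 6) < 1)
    (P : B12.RunParams) (hI : (C P).flow.InInterval γ P.K) :
    ∃ Rj : ℕ → ℕ, (∀ j, B14.IsRj L p ((C P).flow.g j) (Rj j)) ∧
      (B14.FlowIneq26 (C P).flow.g β' β₀ P.K ∧ B14.FlowIneq27 (C P).flow.g β' β₀ p P.K ∧
        B14.FlowIneq28 (epsK A₀ p (C P).flow) (C P).flow.g β' β₀ P.K ∧
        B14FlowStep.FlowIneq29 Rj (C P).flow.g L β' β₀ P.K) ∧ B14FlowStep.SumIneq246 (C P).flow.g κ₀ P.K :=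
  flowControl_along_of_marginalBounded' hgen hhalt hcur S Sm hA₀ hγ₀ hb (marginalBounded_of_oneLoopDrift hdrift) hAF1
    hCr hCrγ hup hAγ hAγ' hκ hsmall P hI

/-- **(AvAF) along runs from the DRIFT carrier** (slope `b/2`, defect `2A`) — the running inequality that ALSO feeds the
ratio-robust (2.46) of `B14Sum246Ratio.sum246_of_ratioWeight_avgAF` (cell GAPS G-adv3-31 / C-sb14-17), so the located
exponent loss of the per-domain (2.44)-for-𝐑 bound stays invisible under V22 as well. [folklore] -/
theorem drift_avgAF_along {C : B12.Construction} {β : HBeta} (hcur : CurriesHBeta C β)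
    (S : B12Beta.OneLoopSplit β) {γ γ₀ b A Cr : ℝ} (hγ₀ : γ ≤ γ₀) (hdrift : Drift.OneLoopDrift b A S.β0)
    (hAF1 : ∀ k (q : Fin (k + 1) → ℝ), q ∈ B12Beta.HistBox γ₀ k → |S.β1 k q| ≤ Cr * q (Fin.last k))
    (hCr : 0 ≤ Cr) (hCrγ : 2 * (Cr * γ) ≤ b) (P : B12.RunParams) (hI : (C P).flow.InInterval γ P.K) :
    ∀ m n, m ≤ n → n ≤ P.K →
      b / 2 * ((n : ℝ) - m) - 2 * A ≤ ∑ j ∈ Finset.Ico m n, (C P).flow.β (j + 1) ((C P).flow.g j) :=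
  avgAF_along_of_marginalBounded hcur S hγ₀ (marginalBounded_of_oneLoopDrift hdrift) hAF1 hCr hCrγ P hI

/-- **(2.46) alone from the DRIFT carrier** along an in-interval run (`κ₀ ≥ 6`). [cite: Balaban1988Convergent, (2.46) p.263] -/
theorem drift_sum246_along {C : B12.Construction} {β : HBeta} (hgen : ForwardGenerated C β)
    (hhalt : HaltsOutside C β) (hcur : CurriesHBeta C β) (S : B12Beta.OneLoopSplit β) {γ γ₀ b A Cr : ℝ}
    (hγ₀ : γ ≤ γ₀) (hb : 0 < b) (hdrift : Drift.OneLoopDrift b A S.β0)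
    (hAF1 : ∀ k (q : Fin (k + 1) → ℝ), q ∈ B12Beta.HistBox γ₀ k → |S.β1 k q| ≤ Cr * q (Fin.last k))
    (hCr : 0 ≤ Cr) (hCrγ : 2 * (Cr * γ) ≤ b) (hAγ' : 2 * A * γ ^ 2 ≤ 1 / 2) {κ₀ : ℕ} (hκ : 6 ≤ κ₀)
    (hsmall : Real.sqrt 2 ^ (κ₀ - 6) * (2 * γ ^ 4 / (b / 2) + γ ^ 6) < 1)
    (P : B12.RunParams) (hI : (C P).flow.InInterval γ P.K) :
    B14FlowStep.SumIneq246 (C P).flow.g κ₀ P.K :=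
  sum246_along_of_marginalBounded hgen hhalt hcur S hγ₀ hb (marginalBounded_of_oneLoopDrift hdrift) hAF1 hCr hCrγ hAγ'
    hκ hsmall P hI

end DriftCarrier

end

end Literature.MathematicalPhysics.QuantumFieldTheory.Balaban1983to89.Beta.FlowConsumers
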